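import Summits.QuantumFields.YangMills.Theorems.BalabanUVNodesN15KingModelPotentialSiteSizeOnly
import Summits.QuantumFields.YangMills.Theorems.BalabanUVNodesN15KingModelPotentialDressedRateNE2
import Summits.QuantumFields.YangMills.Theorems.BalabanUVNodesN15KingModelPotentialMonotone

/-!
# N15 (NE2⁺), King-model rung, part 22: SIZE ALONE DOES NOT GIVE THE UNIT LAYER — the (4.38)-type η-rate of the dressed covariances fails
# without the coherence letter

Cell `pub-ymgap-dag-n15-d` (R134 acceleration DAG, node N15 = NE2, strategy s3 KING-MODEL RUNG), part 22.  Part 10d (`…PotentialDressedRateNE2`)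
inhabited `T4EtaRate.NE2PlusUnit c₃₅ (kingInstanceV L s) (kingKerVW L a m² s) ⊤ tdistT` BY NAME: the one-step η-difference of the covariances
`C^{(j)}_v = (Δ^{(j)}_{v} + aL⁻²Q*Q)⁻¹` of King's tower FULLY dressed by a potential tower `v` obeys the (4.38)-type bound `B₀e^{−δ₀|y−y′|}θ^k`
uniformly over the window — under BOTH regularity slots of part 8c's sort `potBg`, (3.35) := size and (3.36) := one-step coherence.  Part 20
showed that the (H3) LETTER behind that proof fails without coherence; THIS FILE shows that the CONCLUSION fails too:

* §1 quantitative operator antitonicity (from part 9g's completing-the-square identity `two_dot_sub_form_eq`): for symmetric coercive `S`, `T`,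
  `⟨x,S⁻¹x⟩ − ⟨x,T⁻¹x⟩ ≥ ⟨T⁻¹x,(T − S)T⁻¹x⟩` (`form_inv_sub_ge`); `⟨x,T⁻¹x⟩ ≥ Λ⁻¹‖x‖²` from `T ≤ Λ` (`form_inv_ge_of_form_le`); hence
  `(S⁻¹ − T⁻¹)(b,b) ≥ G∕Λ²` when `T − S ≥ G` as forms (`inv_sub_inv_diag_ge`);
* §2 the objects: a constant potential dresses `Δ^{(k)}` into `Δ^{(k)}|_{m² ↦ m²+c}` (`effLaplacianPot_const`); the witness tower `v_{L^k} ≡ c`,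
  `v_N ≡ 0` else has dressed levels `Δ^{(k)}_{m²+c}` and `Δ^{(k+1)}_{m²}` (`kingTowerPot_witness_k ∕ _succ`); form facts for
  `S = Δ^{(k)}_{m²} + B ≤ T = Δ^{(k)}_{m²+c} + B ≤ 2a` (symmetric, coercive `γ₀`, gap `G_min` of part 21);
* §3 ★ `kingKerVW_sizeOnly_ge`: the dressed unit kernel of the witness at `(b,b)` is `≥ G_min∕(4a²) − K·L^{−k}` ((4.38) for the undressed step,
  part 3's `covarianceTowerRate_kingTower`, + §1 for the mass step);
* §4 ★★ `ne2PlusUnit_false_without_coherence`: the definiens of `T4EtaRate.NE2PlusUnit c₃₅ (kingInstanceV L s) (kingKerVW L a m² s) ⊤ tdistT`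
  WITH ITS `Reg336` HYPOTHESIS DELETED is FALSE for every `c₃₅ > 0` and `s`: given `(δ₀, a₀, B₀, θ)` take the index `(e,k,n,Msz) = (0, k, 1, 1)` with
  `k` large, `α₀ = a₀`, and the tower above at `c = c₃₅a₀`.  So part 10d's `ne2PlusUnit_kingVW` genuinely uses its coherence hypothesis.

HONEST SCOPE.  King's A = 0 scalar model on the King-admissible tori `Π ℤ∕(2L^{e+1})`, `L ≥ 2`, `a, m² > 0`; scalar potentials (NOT gauge fields); a
NEGATIVE statement about THIS LINEAGE's family∕sort, not about a printed proposition and not about Bałaban's `C^{(k)}(Λ;U)`; count-neutral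
(`--supports`), not a discharge of N15; THEOREMS ONLY (0 `def`, 0 `sorry`), standard axioms.

References: C. King, Commun. Math. Phys. 102 (1986) 649–677: (2.13)–(2.14) p.653, (4.5) p.670, (4.32)–(4.35) p.674, Lemma 4.5 (4.38) p.674
(bib key `King1986`); [B9] = Bałaban, Commun. Math. Phys. 102 (1985) 385–462, (3.35)–(3.36) p.396, Thm 3.15 (3.187) p.432 (quantifier template)
(bib key `Balaban1985BackgroundPropagators`).
-/

noncomputable section
open scoped BigOperators Matrix
open Finset

namespace Summit.QuantumFields.YangMills.BalabanUVNodes.N15.KingModel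

open Literature.MathematicalPhysics.QuantumFieldTheory.Balaban1983to89 hiding blockOf
open Literature.MathematicalPhysics.QuantumFieldTheory.Balaban1983to89.QGQInverse (Coercive isUnit_of_coercive)
open Literature.MathematicalPhysics.QuantumFieldTheory.Balaban1983to89.T4EtaRate (PairedInstance NE2PlusUnit EtaRateIneqUnit)
open Literature.MathematicalPhysics.QuantumFieldTheory.Balaban1983to89.B5Prop11Plancherel (Tor fine)
open Literature.MathematicalPhysics.QuantumFieldTheory.King1986 (aK aK_pos)
open Literature.MathematicalPhysics.QuantumFieldTheory.King1986.Torus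
open Summit.QuantumFields.BalabanUV.T4Continuum.NE2KingTransplant (UniformCoercive CovarianceTowerRate)
open Real

variable {d : ℕ}

/-! ## §1 Quantitative operator antitonicity of the inverse -/

section Antitone

variable {n : Type} [Fintype n] [DecidableEq n]

/-- **QUANTITATIVE ANTITONICITY**: `S` symmetric coercive, `T` invertible, `y = T⁻¹x` ⇒ `⟨x,S⁻¹x⟩ − ⟨x,T⁻¹x⟩ ≥ ⟨y,Ty⟩ − ⟨y,Sy⟩` (part 9g's
completing-the-square identity: `⟨x,S⁻¹x⟩ − 2⟨x,y⟩ + ⟨y,Sy⟩ = ⟨y − S⁻¹x, S(y − S⁻¹x)⟩ ≥ 0`). [folklore] -/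
theorem form_inv_sub_ge {S T : Matrix n n ℝ} (hS : Sᵀ = S) {γ : ℝ} (hγ : 0 < γ) (hSc : Coercive S γ) (hT : IsUnit T) (x : n → ℝ) :
    (T⁻¹ *ᵥ x) ⬝ᵥ (T *ᵥ (T⁻¹ *ᵥ x)) - (T⁻¹ *ᵥ x) ⬝ᵥ (S *ᵥ (T⁻¹ *ᵥ x)) ≤ x ⬝ᵥ (S⁻¹ *ᵥ x) - x ⬝ᵥ (T⁻¹ *ᵥ x) := by
  set y := T⁻¹ *ᵥ x with hy
  have hTdet : IsUnit T.det := (Matrix.isUnit_iff_isUnit_det T).mp hT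
  have hTy : T *ᵥ y = x := by rw [hy, Matrix.mulVec_mulVec, Matrix.mul_nonsing_inv T hTdet, Matrix.one_mulVec]
  have hU : IsUnit S := isUnit_of_coercive hγ hSc
  have hsq := two_dot_sub_form_eq hS hU x y
  have hpos : 0 ≤ (y - S⁻¹ *ᵥ x) ⬝ᵥ (S *ᵥ (y - S⁻¹ *ᵥ x)) :=
    le_trans (mul_nonneg hγ.le (Literature.LinearAlgebra.Matrix.dotProduct_self_nonneg_real _)) (hSc _)
  have h1 : y ⬝ᵥ (T *ᵥ y) = x ⬝ᵥ y := by rw [hTy, dotProduct_comm]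
  rw [h1]
  linarith

/-- **A LOWER BOUND FOR THE INVERSE FORM FROM AN UPPER BOUND FOR THE FORM**: `T` symmetric coercive with `⟨y,Ty⟩ ≤ Λ‖y‖²` (`Λ > 0`) ⇒
`⟨x,T⁻¹x⟩ ≥ Λ⁻¹‖x‖²` (complete the square at `y = Λ⁻¹x`). [folklore] -/
theorem form_inv_ge_of_form_le {T : Matrix n n ℝ} (hT : Tᵀ = T) {γ : ℝ} (hγ : 0 < γ) (hTc : Coercive T γ) {Λ : ℝ} (hΛ : 0 < Λ)
    (hle : ∀ y : n → ℝ, y ⬝ᵥ (T *ᵥ y) ≤ Λ * (y ⬝ᵥ y)) (x : n → ℝ) : Λ⁻¹ * (x ⬝ᵥ x) ≤ x ⬝ᵥ (T⁻¹ *ᵥ x) := by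
  have hU : IsUnit T := isUnit_of_coercive hγ hTc
  set y : n → ℝ := Λ⁻¹ • x with hy
  have hsq := two_dot_sub_form_eq hT hU x y
  have hpos : 0 ≤ (y - T⁻¹ *ᵥ x) ⬝ᵥ (T *ᵥ (y - T⁻¹ *ᵥ x)) :=
    le_trans (mul_nonneg hγ.le (Literature.LinearAlgebra.Matrix.dotProduct_self_nonneg_real _)) (hTc _)
  have h1 : x ⬝ᵥ y = Λ⁻¹ * (x ⬝ᵥ x) := by rw [hy, dotProduct_smul, smul_eq_mul]
  have h2 : y ⬝ᵥ y = Λ⁻¹ * Λ⁻¹ * (x ⬝ᵥ x) := by rw [hy, dotProduct_smul, smul_dotProduct, smul_eq_mul, smul_eq_mul, mul_assoc]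
  have h3 := hle y
  have h4 : Λ * (Λ⁻¹ * Λ⁻¹ * (x ⬝ᵥ x)) = Λ⁻¹ * (x ⬝ᵥ x) := by field_simp
  rw [h2, h4] at h3
  linarith

/-- **THE DIAGONAL OF `S⁻¹ − T⁻¹` IS BOUNDED BELOW BY THE GAP**: `S`, `T` symmetric and coercive, `⟨y,(T − S)y⟩ ≥ G‖y‖²` (`G ≥ 0`) and `⟨y,Ty⟩ ≤ Λ‖y‖²`
(`Λ > 0`) ⇒ `S⁻¹(b,b) − T⁻¹(b,b) ≥ G∕Λ²` at every `b` (`§1`: `≥ ⟨y,(T−S)y⟩ ≥ G‖y‖² ≥ G·y_b² = G·T⁻¹(b,b)² ≥ G∕Λ²`, `y = T⁻¹δ_b`). [folklore] -/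
theorem inv_sub_inv_diag_ge {S T : Matrix n n ℝ} (hS : Sᵀ = S) (hT : Tᵀ = T) {γ : ℝ} (hγ : 0 < γ) (hSc : Coercive S γ)
    (hTc : Coercive T γ) {G Λ : ℝ} (hG : 0 ≤ G) (hΛ : 0 < Λ)
    (hgap : ∀ y : n → ℝ, G * (y ⬝ᵥ y) ≤ y ⬝ᵥ (T *ᵥ y) - y ⬝ᵥ (S *ᵥ y)) (hle : ∀ y : n → ℝ, y ⬝ᵥ (T *ᵥ y) ≤ Λ * (y ⬝ᵥ y))
    (b : n) : G * (Λ⁻¹) ^ 2 ≤ S⁻¹ b b - T⁻¹ b b := by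
  have hTu : IsUnit T := isUnit_of_coercive hγ hTc
  set x : n → ℝ := Pi.single b 1 with hx
  have h1 := form_inv_sub_ge hS hγ hSc hTu x
  have h2 := hgap (T⁻¹ *ᵥ x)
  have h3 := form_inv_ge_of_form_le hT hγ hTc hΛ hle x
  have hxS : x ⬝ᵥ (S⁻¹ *ᵥ x) = S⁻¹ b b := by
    simp only [hx, Matrix.mulVec_single_one, single_dotProduct, one_mul, Matrix.col_apply]
  have hxT : x ⬝ᵥ (T⁻¹ *ᵥ x) = T⁻¹ b b := by
    simp only [hx, Matrix.mulVec_single_one, single_dotProduct, one_mul, Matrix.col_apply]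
  have hxx : x ⬝ᵥ x = 1 := by
    simp only [hx, single_dotProduct, one_mul, Pi.single_eq_same]
  have hyb : (T⁻¹ *ᵥ x) b = T⁻¹ b b := by
    simp only [hx, Matrix.mulVec_single_one, Matrix.col_apply]
  have hyy : (T⁻¹ b b) ^ 2 ≤ (T⁻¹ *ᵥ x) ⬝ᵥ (T⁻¹ *ᵥ x) := by
    rw [← hyb, sq]
    exact Finset.single_le_sum (f := fun z => (T⁻¹ *ᵥ x) z * (T⁻¹ *ᵥ x) z) (fun z _ => mul_self_nonneg _) (Finset.mem_univ b)
  rw [hxS, hxT] at h1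
  rw [hxx, mul_one, hxT] at h3
  have hTbb : 0 < T⁻¹ b b := lt_of_lt_of_le (by positivity) h3
  have h4 : (Λ⁻¹) ^ 2 ≤ (T⁻¹ b b) ^ 2 := pow_le_pow_left₀ (by positivity) h3 2
  calc G * (Λ⁻¹) ^ 2 ≤ G * (T⁻¹ b b) ^ 2 := mul_le_mul_of_nonneg_left h4 hG
    _ ≤ G * ((T⁻¹ *ᵥ x) ⬝ᵥ (T⁻¹ *ᵥ x)) := mul_le_mul_of_nonneg_left hyy hG
    _ ≤ _ := h2
    _ ≤ _ := h1

end Antitone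

/-! ## §2 The objects: constant potentials, the witness tower's levels, form facts -/

section Objects

variable {N : ℕ} [NeZero N] {U : Fin (d + 1) → ℕ} [∀ μ, NeZero (U μ)]

/-- **A CONSTANT POTENTIAL DRESSES `Δ^{(k)}` INTO A MASS SHIFT**: `Δ_eff(t·1) = Δ_eff|_{m² ↦ m²+t}`. [cite: King1986, (2.14) p.653, (4.5) p.670] -/
theorem effLaplacianPot_const (a c m2 t : ℝ) : effLaplacianPot N U a c m2 (fun _ => t) = effLaplacian N U a c (m2 + t) := by
  rw [effLaplacianPot, effLaplacian, fineOpPot_const]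

variable (L : ℕ) [NeZero L] {M : Fin (d + 1) → ℕ} [∀ μ, NeZero (M μ)] (a m2 : ℝ)

/-- The witness tower's dressed level `k` is `Δ^{(k)}_{m²+c}` (`k ≥ 1`). [cite: King1986, (2.14) p.653] -/
theorem kingTowerPot_witness_k {k : ℕ} (hk : 1 ≤ k) (c : ℝ) :
    kingTowerPot a m2 L M (fun N _ => if N = L ^ k then c else 0) k = kingLevel a (m2 + c) L M k := by
  rw [kingTowerPot_of_one_le _ hk]
  show effLaplacianPot (L ^ k) (fine L M) (aK a L k) (((L ^ k : ℕ) : ℝ) ^ 2) m2 (fun _ => if L ^ k = L ^ k then c else 0) = _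
  simp only [if_true, effLaplacianPot_const]
  rfl

/-- The witness tower's dressed level `k + 1` is the undressed `Δ^{(k+1)}_{m²}` (`L ≥ 2`). [cite: King1986, (2.14) p.653] -/
theorem kingTowerPot_witness_succ (hL : 2 ≤ L) (k : ℕ) (c : ℝ) :
    kingTowerPot a m2 L M (fun N _ => if N = L ^ k then c else 0) (k + 1) = kingLevel a m2 L M (k + 1) := by
  have hne : ¬ (L ^ (k + 1) = L ^ k) := by
    have h1 : L ^ k < L ^ (k + 1) := Nat.pow_lt_pow_right (by omega) (by omega)
    omega
  rw [kingTowerPot_of_one_le _ (by omega : 1 ≤ k + 1)]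
  show effLaplacianPot (L ^ (k + 1)) (fine L M) (aK a L (k + 1)) (((L ^ (k + 1) : ℕ) : ℝ) ^ 2) m2
    (fun _ => if L ^ (k + 1) = L ^ k then c else 0) = _
  simp only [if_neg hne, effLaplacianPot_const, add_zero]
  rfl

variable {L a m2}

/-- `Δ^{(k)} + aL⁻²Q*Q` is symmetric. [cite: King1986, (4.32) p.674] -/
theorem kingLevel_add_block_transpose (k : ℕ) : (kingLevel a m2 L M k + kingBlock a L M)ᵀ = kingLevel a m2 L M k + kingBlock a L M := by
  ext x y
  rw [Matrix.transpose_apply, Matrix.add_apply, Matrix.add_apply]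
  show effLaplacian _ _ _ _ _ y x + kingBlock a L M y x = effLaplacian _ _ _ _ _ x y + kingBlock a L M x y
  rw [effLaplacian_symm, kingBlock_symm]

/-- `Δ^{(k)} + aL⁻²Q*Q ≥ γ₀` at every level `k ≥ 1` (King's (4.33), part 3's `uniformCoercive_kingTower`). [cite: King1986, (4.33) p.674] -/
theorem kingLevel_add_block_coercive (ha : 0 < a) (hm : 0 < m2) (hL : 2 ≤ L) {k : ℕ} (hk : 1 ≤ k) :
    Coercive (kingLevel a m2 L M k + kingBlock a L M) (gam0L (d + 1) a L) := by
  have h := uniformCoercive_kingTower (M := M) ha hm hL k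
  rwa [kingTower_of_one_le hk] at h

/-- `Δ^{(k)} + aL⁻²Q*Q ≤ 2a` as forms (`Δ^{(k)} ≤ a` by (4.5)∕(4.35), `Q*Q ≤ 1`, `L ≥ 2`). [cite: King1986, (4.5) p.670, (4.32)–(4.35) p.674] -/
theorem kingLevel_add_block_form_le (ha : 0 < a) (hm : 0 < m2) (hL : 2 ≤ L) {k : ℕ} (hk : 1 ≤ k) (y : Tor (fine L M) → ℝ) :
    y ⬝ᵥ ((kingLevel a m2 L M k + kingBlock a L M) *ᵥ y) ≤ 2 * a * (y ⬝ᵥ y) := by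
  have hLr : (1 : ℝ) < L := by exact_mod_cast (show 1 < L by omega)
  have hak : 0 < aK a L k := aK_pos ha hLr hk
  have haka : aK a L k ≤ a := (aminL_le_aK ha hL hk).2
  have hN1 : 1 ≤ L ^ k := Nat.one_le_pow _ _ (by omega)
  have hyy : 0 ≤ y ⬝ᵥ y := Literature.LinearAlgebra.Matrix.dotProduct_self_nonneg_real y
  rw [Matrix.add_mulVec, dotProduct_add]
  have h1 : y ⬝ᵥ (kingLevel a m2 L M k *ᵥ y) ≤ a * (y ⬝ᵥ y) := by
    have h := effLaplacian_form_le_zone (L ^ k) (fine L M) hN1 hak hm y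
    have hcoef : ((aK a L k)⁻¹ + (4 / π ^ 2) ^ (d + 1) / (((d + 1 : ℕ) : ℝ) * π ^ 2 + m2))⁻¹ ≤ a := by
      calc _ ≤ ((aK a L k)⁻¹)⁻¹ := inv_anti₀ (by positivity) (le_add_of_nonneg_right (by positivity))
        _ = aK a L k := inv_inv _
        _ ≤ a := haka
    have hcast : (((L ^ k : ℕ) : ℝ)) = ((L : ℝ) ^ k) := by push_cast; ring
    calc y ⬝ᵥ (kingLevel a m2 L M k *ᵥ y) = y ⬝ᵥ (effLaplacian (L ^ k) (fine L M) (aK a L k) (((L ^ k : ℕ) : ℝ) ^ 2) m2 *ᵥ y) := rfl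
      _ ≤ _ := h
      _ ≤ a * (y ⬝ᵥ y) := mul_le_mul_of_nonneg_right hcoef hyy
  have h2 : y ⬝ᵥ (kingBlock a L M *ᵥ y) ≤ a * (y ⬝ᵥ y) := by
    rw [kingBlock, Matrix.smul_mulVec, dotProduct_smul, smul_eq_mul]
    have hb := blockProj_form_le L M y
    have hL2 : ((L : ℝ) ^ 2)⁻¹ ≤ 1 := inv_le_one_of_one_le₀ (by nlinarith)
    calc a * ((L : ℝ) ^ 2)⁻¹ * (y ⬝ᵥ (blockProj L M *ᵥ y)) ≤ a * 1 * (y ⬝ᵥ y) :=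
          mul_le_mul (mul_le_mul_of_nonneg_left hL2 ha.le) hb (blockProj_form_nonneg L M y) (by positivity)
      _ = a * (y ⬝ᵥ y) := by ring
  linarith

/-- The mass gap as forms for `Δ^{(k)}_{m²+c} + B` over `Δ^{(k)}_{m²} + B` at the uniform constant `G_min` (part 21's `effLaplacian_mass_gap_form` at
`a_k ≥ a_min`). [cite: King1986, (4.5) p.670, (4.35) p.674] -/
theorem kingLevel_add_block_gap (ha : 0 < a) (hm : 0 < m2) (hL : 2 ≤ L) {k : ℕ} (hk : 1 ≤ k) {c : ℝ} (hc : 0 < c)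
    (y : Tor (fine L M) → ℝ) :
    (4 / π ^ 2) ^ (d + 1) * c / ((((d + 1 : ℕ) : ℝ) * π ^ 2 + m2) * (((d + 1 : ℕ) : ℝ) * π ^ 2 + (m2 + c)))
        * (((aminL a L)⁻¹ + (m2 + c)⁻¹)⁻¹ * ((aminL a L)⁻¹ + m2⁻¹)⁻¹) * (y ⬝ᵥ y)
      ≤ y ⬝ᵥ ((kingLevel a (m2 + c) L M k + kingBlock a L M) *ᵥ y) - y ⬝ᵥ ((kingLevel a m2 L M k + kingBlock a L M) *ᵥ y) := by
  have hLr : (1 : ℝ) < L := by exact_mod_cast (show 1 < L by omega)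
  have hak : 0 < aK a L k := aK_pos ha hLr hk
  have hamin : 0 < aminL a L := aminL_pos ha hL
  have hamk : aminL a L ≤ aK a L k := (aminL_le_aK ha hL hk).1
  have hN1 : 1 ≤ L ^ k := Nat.one_le_pow _ _ (by omega)
  have hyy : 0 ≤ y ⬝ᵥ y := Literature.LinearAlgebra.Matrix.dotProduct_self_nonneg_real y
  have h := effLaplacian_mass_gap_form (L ^ k) (fine L M) hN1 hak hm hc y
  have hmono : (4 / π ^ 2) ^ (d + 1) * c / ((((d + 1 : ℕ) : ℝ) * π ^ 2 + m2) * (((d + 1 : ℕ) : ℝ) * π ^ 2 + (m2 + c)))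
        * (((aminL a L)⁻¹ + (m2 + c)⁻¹)⁻¹ * ((aminL a L)⁻¹ + m2⁻¹)⁻¹)
      ≤ (4 / π ^ 2) ^ (d + 1) * c / ((((d + 1 : ℕ) : ℝ) * π ^ 2 + m2) * (((d + 1 : ℕ) : ℝ) * π ^ 2 + (m2 + c)))
        * (((aK a L k)⁻¹ + (m2 + c)⁻¹)⁻¹ * ((aK a L k)⁻¹ + m2⁻¹)⁻¹) := by
    have hi : (aK a L k)⁻¹ ≤ (aminL a L)⁻¹ := inv_anti₀ hamin hamk
    exact mul_le_mul_of_nonneg_left (mul_le_mul (inv_anti₀ (by positivity) (by linarith))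
      (inv_anti₀ (by positivity) (by linarith)) (by positivity) (by positivity)) (by positivity)
  have hsplit : y ⬝ᵥ ((kingLevel a (m2 + c) L M k + kingBlock a L M) *ᵥ y) - y ⬝ᵥ ((kingLevel a m2 L M k + kingBlock a L M) *ᵥ y)
      = y ⬝ᵥ (effLaplacian (L ^ k) (fine L M) (aK a L k) (((L ^ k : ℕ) : ℝ) ^ 2) (m2 + c) *ᵥ y)
        - y ⬝ᵥ (effLaplacian (L ^ k) (fine L M) (aK a L k) (((L ^ k : ℕ) : ℝ) ^ 2) m2 *ᵥ y) := by
    rw [Matrix.add_mulVec, Matrix.add_mulVec, dotProduct_add, dotProduct_add]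
    show y ⬝ᵥ (effLaplacian _ _ _ _ _ *ᵥ y) + _ - (y ⬝ᵥ (effLaplacian _ _ _ _ _ *ᵥ y) + _) = _
    ring
  have hcast : ((L ^ k : ℕ) : ℝ) ^ 2 = ((L ^ k : ℕ) : ℝ) ^ 2 := rfl
  rw [hsplit]
  exact (mul_le_mul_of_nonneg_right hmono hyy).trans h

end Objects

/-! ## §3 The dressed unit kernel of the witness tower is bounded below -/

section Lower

variable (L : ℕ) [NeZero L]

/-- **THE DRESSED UNIT KERNEL OF THE SIZE-REGULAR INCOHERENT TOWER IS BOUNDED BELOW** (`L ≥ 2`, `a, m² > 0`, `c > 0`): there are `g > 0`, `K ≥ 0`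
with `(kingKerVW L a m² s i).ker v b b ≥ g − K·L^{−i.k}` for the tower `v_N = c·[N = L^{i.k}]`, every `s`, every index and every unit site:
`ker v b b = [(Δ^{(k+1)}_{m²}+B)⁻¹ − (Δ^{(k)}_{m²}+B)⁻¹](b,b) + [(Δ^{(k)}_{m²}+B)⁻¹ − (Δ^{(k)}_{m²+c}+B)⁻¹](b,b)`, the first `≥ −K₄₅L^{−k}` by (4.38) for the
undressed tower (part 3), the second `≥ G_min∕(2a)²` by §1. [cite: King1986, Lemma 4.5 (4.38) p.674, (4.32)–(4.35) p.674, (4.5) p.670 (A = 0 model)] -/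
theorem kingKerVW_sizeOnly_ge (hL : 2 ≤ L) {a m2 : ℝ} (ha : 0 < a) (hm : 0 < m2) {c : ℝ} (hc : 0 < c) :
    ∃ g K : ℝ, 0 < g ∧ 0 ≤ K ∧ ∀ (s : ℝ) (i : KingPotIdx d) (b : Tor (kingU d L i.e)),
      g - K * ((L : ℝ)⁻¹) ^ i.k ≤ (kingKerVW L a m2 s i).ker (fun N _ => if N = L ^ i.k then c else 0) b b := by
  have hamin : 0 < aminL a L := aminL_pos ha hL
  set Gm : ℝ := (4 / π ^ 2) ^ (d + 1) * c / ((((d + 1 : ℕ) : ℝ) * π ^ 2 + m2) * (((d + 1 : ℕ) : ℝ) * π ^ 2 + (m2 + c)))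
    * (((aminL a L)⁻¹ + (m2 + c)⁻¹)⁻¹ * ((aminL a L)⁻¹ + m2⁻¹)⁻¹) with hGmdef
  have hGm : 0 < Gm := by positivity
  have hKC : 0 ≤ kingC (d + 1) a L := kingC_nonneg (d + 1) a L
  refine ⟨Gm * ((2 * a)⁻¹) ^ 2, kingC (d + 1) a L, by positivity, hKC, fun s i b => ?_⟩
  set k := i.k with hkdef
  have hk : 1 ≤ k := i.one_le_k
  have hγ := gam0L_pos (d := d + 1) ha hL
  -- the kernel entry in terms of the two covariances
  rw [kingKerVW_apply, kingTowerPot_witness_succ L a m2 hL k c, kingTowerPot_witness_k L a m2 hk c]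
  -- the undressed step, by (4.38)
  have hstep : |(kingLevel a m2 L (kingM d L i.e) k + kingBlock a L (kingM d L i.e))⁻¹ b b
        - (kingLevel a m2 L (kingM d L i.e) (k + 1) + kingBlock a L (kingM d L i.e))⁻¹ b b|
      ≤ kingC (d + 1) a L * ((L : ℝ)⁻¹) ^ k := by
    have h := covarianceTowerRate_kingTower (M := kingM d L i.e) ha hm hL k b b
    rw [kingTower_of_one_le hk, kingTower_of_one_le (by omega : 1 ≤ k + 1), (tdistT_isPseudoDist (fine L (kingM d L i.e))).zero,
      mul_zero, neg_zero, Real.exp_zero, mul_one] at h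
    exact h
  -- the mass step, by §1
  have hmass : Gm * ((2 * a)⁻¹) ^ 2
      ≤ (kingLevel a m2 L (kingM d L i.e) k + kingBlock a L (kingM d L i.e))⁻¹ b b
        - (kingLevel a (m2 + c) L (kingM d L i.e) k + kingBlock a L (kingM d L i.e))⁻¹ b b :=
    inv_sub_inv_diag_ge (kingLevel_add_block_transpose k) (kingLevel_add_block_transpose k) hγ
      (kingLevel_add_block_coercive ha hm hL hk) (kingLevel_add_block_coercive ha (by linarith) hL hk) hGm.le (by positivity)
      (fun y => kingLevel_add_block_gap ha hm hL hk hc y) (fun y => kingLevel_add_block_form_le ha (by linarith) hL hk y) b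
  have habs := le_of_abs_le hstep
  linarith

end Lower

/-! ## §4 The unit layer's η-rate fails without the coherence letter -/

section NotUnit

variable (L : ℕ) [NeZero L]

/-- **`NE2PlusUnit` WITHOUT ITS (3.36) HYPOTHESIS IS FALSE FOR THE DRESSED COVARIANCES** (`L ≥ 2`, `a, m² > 0`; every `c₃₅ > 0`, `s`): the
definiens of `T4EtaRate.NE2PlusUnit c₃₅ (kingInstanceV L s) (kingKerVW L a m² s) ⊤ tdistT` with the conjunct `Reg336 c₃₅ α₀ U →` deleted does
not hold — given `(δ₀, a₀, B₀, θ)`, the index `(0, k, 1, 1)` with `k` large, `α₀ = a₀` and the (3.35)-regular tower `v_N = c₃₅a₀·[N = L^k]` violate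
`EtaRateIneqUnit` at `(b,b)` (§3 against `B₀θ^k`).  CONTRAST: with the coherence letter the predicate HOLDS by name (part 10d `ne2PlusUnit_kingVW`).
HONEST SCOPE: module docstring. [cite: Balaban1985BackgroundPropagators, (3.35)–(3.36) p.396 + Thm 3.15 (3.187) p.432 (quantifier template); King1986, Lemma 4.5 (4.38) p.674 (A = 0 model)] -/
theorem ne2PlusUnit_false_without_coherence (hL : 2 ≤ L) {a m2 : ℝ} (ha : 0 < a) (hm : 0 < m2) {c35 : ℝ} (hc : 0 < c35) (s : ℝ) :
    ¬ ∃ δ₀ a₀ B₀ θ : ℝ, 0 < δ₀ ∧ 0 < a₀ ∧ 0 < B₀ ∧ 0 < θ ∧ θ < 1 ∧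
      ∀ (i : KingPotIdx d) (α₀ : ℝ), 0 < α₀ → (kingInstanceV (d := d) L s i).gf.M * α₀ ≤ a₀ →
        ∀ v : (kingInstanceV (d := d) L s i).Bf.Cfg, (kingInstanceV (d := d) L s i).Bf.Reg335 c35 α₀ v →
          EtaRateIneqUnit (kingKerVW L a m2 s i) (fun _ => True) (kingDistV L s i) B₀ δ₀ θ (kingInstanceV (d := d) L s i).gc.k v := by
  rintro ⟨δ₀, a₀, B₀, θ, hδ, ha₀, hB, hθ0, hθ1, H⟩
  have hcα : 0 < c35 * a₀ := by positivity
  obtain ⟨g, K, hg, hK, Hlow⟩ := kingKerVW_sizeOnly_ge (d := d) L hL ha hm hcα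
  -- a level beating both rates
  have hLr : (1 : ℝ) < L := by exact_mod_cast (show 1 < L by omega)
  set r : ℝ := (L : ℝ)⁻¹ with hrdef
  have hr0 : 0 ≤ r := by positivity
  have hr1 : r < 1 := inv_lt_one_of_one_lt₀ hLr
  obtain ⟨n₁, hn₁⟩ := exists_pow_lt_of_lt_one (show 0 < g / 4 / (K + 1) by positivity) hr1
  obtain ⟨n₂, hn₂⟩ := exists_pow_lt_of_lt_one (show 0 < g / 4 / B₀ by positivity) hθ1
  set k : ℕ := n₁ + n₂ + 1 with hkdef
  have hk1 : 1 ≤ k := by omega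
  have hrk : r ^ k ≤ r ^ n₁ := pow_le_pow_of_le_one hr0 hr1.le (by omega)
  have hθk : θ ^ k ≤ θ ^ n₂ := pow_le_pow_of_le_one hθ0.le hθ1.le (by omega)
  have hsmall₁ : K * r ^ k ≤ g / 4 := by
    have h1 : K * r ^ k ≤ (K + 1) * r ^ n₁ := mul_le_mul (by linarith) hrk (pow_nonneg hr0 _) (by linarith)
    have h3 : (K + 1) * (g / 4 / (K + 1)) = g / 4 := by field_simp
    linarith [mul_le_mul_of_nonneg_left hn₁.le (by linarith : (0 : ℝ) ≤ K + 1)]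
  have hsmall₂ : B₀ * θ ^ k ≤ g / 4 := by
    have h3 : B₀ * (g / 4 / B₀) = g / 4 := by field_simp
    linarith [mul_le_mul_of_nonneg_left (hθk.trans hn₂.le) hB.le]
  -- the index `(0, k, 1, 1)`, the site, and the (3.35)-regular incoherent tower at `α₀ = a₀`
  set i : KingPotIdx d := ⟨0, k, hk1, 1, le_rfl, 1, le_rfl⟩ with hidef
  set b : Tor (kingU d L 0) := fun _ => 0 with hbdef
  have h335 : (kingInstanceV (d := d) L s i).Bf.Reg335 c35 a₀ (fun N _ => if N = L ^ k then c35 * a₀ else 0) := by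
    intro N x
    show |(if N = L ^ k then c35 * a₀ else (0 : ℝ))| ≤ c35 * a₀
    by_cases h : N = L ^ k
    · rw [if_pos h, abs_of_pos hcα]
    · rw [if_neg h, abs_zero]; exact hcα.le
  have hMa : (kingInstanceV (d := d) L s i).gf.M * a₀ ≤ a₀ := by
    show (1 : ℝ) * a₀ ≤ a₀
    rw [one_mul]
  have hineq := H i a₀ ha₀ hMa _ h335 b b trivial trivial
  have hexp : Real.exp (-(δ₀ * kingDistV (d := d) L s i b b)) ≤ 1 := by
    rw [Real.exp_le_one_iff]
    have h0 : 0 ≤ kingDistV (d := d) L s i b b := (tdistT_isPseudoDist (kingU d L 0)).nonneg b b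
    nlinarith
  have hup : (kingKerVW L a m2 s i).ker (fun N _ => if N = L ^ k then c35 * a₀ else 0) b b ≤ B₀ * θ ^ k := by
    refine (le_abs_self _).trans (hineq.trans ?_)
    have : B₀ * Real.exp (-(δ₀ * kingDistV (d := d) L s i b b)) ≤ B₀ := mul_le_of_le_one_right hB.le hexp
    exact mul_le_mul_of_nonneg_right this (pow_nonneg hθ0.le _)
  have hlow := Hlow s i b
  rw [show i.k = k from rfl] at hlow
  linarith

end NotUnit

end Summit.QuantumFields.YangMills.BalabanUVNodes.N15.KingModel

end
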